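import Mathlib
import HarnessLib
import Summits.NavierStokesRegularity.NavierStokesRegularity.Theorems.TaylorModelRungThreeCertificateFormat

/-!
# Crux K1b-DR (stmt-NavierStokesRegularity-23954), line `taylor-model` — the executable checker of the
# `Readouts` block of `CertData.Valid` (CERT-CONTRACT-23954 v1 §4 READOUTS), format of record p602753

`Theorems/TaylorModelRungThreeCertificateFormat.lean` fixes the tables `TaylorModelCert.CertTables K` and their
interpretation `CertTables.toCertData φ T : TaylorChain.CertData`, and checks the `Chain` block. This module adds the
Boolean checker of the `Readouts` block of `CertData.Valid` (TaylorChainCertificate.lean, `CertData.Readouts`), clause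
family by clause family, over the SAME tables plus one small record `ReadoutAux K` of one-sided dyadic SURROGATES for
the three irrational constants the block mentions (`2^(-θ)`, `2^(3(Kb+1)/4)`, `√(10·Cg·2^(-7(Ka+1)))`), each certified by
an exact check in `K` (`checkReadoutAux`):

* `checkRO_products`  — the flow-Lipschitz product clauses for `Λ j` (exact arithmetic, `∏ (1 + κB)` as `prodIco`);
* `checkRO_scalars`   — `0 < γ`, the `Nσ` row sum of the section covector, the `ΛX` clause, `0 ≤ NDL ∧ NDL·ΛX·dm ≤ β`,
  and the `L1`-guard `1/(1 - bb(mC+ρO)h)² ≤ L1` (as `q' < 1 ∧ 1 ≤ L1 (1-q')²`);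
* `checkRO_section`   — SECTION BEFORE / AFTER: `sup` / `inf` of the linear functional `σf` over `x + Cm(rP-box) + E-ball`
  as `σf·x ± (Σ |σfᵀCm| rP + E Σ|σf| ω)`;
* `checkRO_crossing`  — the E1 read-outs at the crossing states `y = TP u + w'` (`u ∈ [0,h]`, `w' ∈ Ball(Sp)`, last
  sub-step), IGNORING the section equation (sound: it only shrinks the set): `as ≤ |y_{i₀,1}|` via the reverse triangle
  inequality on the Taylor polynomial, the behind-shell clause against the surrogate `pθ·Cb·r34 ≤ 2^(-θ)·Cb·2^(3(Kb+1)/4)`,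
  and the landing-DERIVATIVE bound `|ℓ (nx j) l (landD y v z)| ≤ NDL` via the closed-form monotone majorant of `landD`
  (divisions by the certified lower bound `a > 0` of `|y_{i₀,1}|`);
* `checkRO_land`      — the base-landing polytope clause (`SpI` ball): every coordinate of `land y v` is enclosed by the
  interval quotient `Lv·[Ylo, Yhi]/[a, A]` (extrema at the corners), giving a centre `m_c` and radius `ρ_c` computed by the
  checker itself, and `|Σ ell·m − ctr| + Σ |ell|·ρ + β ≤ rad − s` is tested for every face index below the table lengths.

* `checkRO_trans`     — TRANSVERSALITY `γ ≤ σf (Qb y y)`: `g(u) = σf (Qb (TP u) (TP u))` is a polynomial of degree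
  `2·pdeg` with coefficients `G_{q,q'} = σf · QbVec (P q) (P q')` exact in `K` (through the `coef` table — its meaning
  rests on the `CoefOK` hypothesis of `…CertificateSoundField`); crude lower bound `G₀₀ − Σ' |G| h^(q+q')`, and the
  cross / spread terms bounded through the stage's bilinear bound `bb` (a `StageNumerics` clause, taken as a hypothesis
  by the soundness theorem): `γ ≤ trLow − (2·bb·mT·Sp + bb·Sp²)·Σ|σf|ω`;
* `checkReadoutsStage` / `checkReadouts` — the conjunction over the stages `j ≤ N₀` with `checkReadoutAux`.

Window coordinates, list coding and junk conventions exactly as in the format file. SOUNDNESS (`Readouts` of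
`toCertData φ T` from `checkReadouts = true` under a monotone `φ : K →+* ℝ`, `CoefOK φ T` and the `StageNumerics`
block) is proved in the `…CertificateReadouts{Sound,Enclosure,Land,Trans}` files; this file asserts nothing.

MODEL-lattice bookkeeping only (rung TL-M3, Tao-type averaged cascade); nothing here is a statement about the Navier–Stokes
equations.
-/

-- the sub-problem namespace repeats the summit name by design (D-0017)
set_option linter.dupNamespace false

namespace Summit.NavierStokesRegularity.NavierStokesRegularity.Theorems.TaylorModelCert

open scoped BigOperators
open Literature.Analysis.FluidPDE.TaoCascade Literature.Analysis.FluidPDE.TaoCascade.TaylorChain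

/-! ### List-coded finite products -/

section ListOps

variable {K : Type} [Field K]

/-- `∏_{c<n} f c`, list-coded. [folklore] -/
def prodN (n : ℕ) (f : ℕ → K) : K := (List.range n).foldr (fun c acc => f c * acc) 1

/-- `∏_{a ≤ u < b} f u`, list-coded (`Finset.Ico a b`). [folklore] -/
def prodIco (a b : ℕ) (f : ℕ → K) : K := prodN (b - a) fun t => f (a + t)

end ListOps

/-- Auxiliary SURROGATE data for the `Readouts` checker (CERT-CONTRACT §4: the block compares against three constants
that are irrational in general and hence not elements of `K`): the design exponent `θ = θnum/θden`, a LOWER surrogate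
`pθ ≤ 2^(-θ)` (certified by `pθ ≥ 0 ∧ pθ^θden · 2^θnum ≤ 1`), a LOWER surrogate `r34 ≤ 2^(3(Kb+1)/4)` (certified by
`r34 ≥ 0 ∧ r34⁴ ≤ 2^(3(Kb+1))`), and an UPPER surrogate `tv ≥ √(10·Cg·2^(-7(Ka+1)))` of the tail half-width (certified
by `tv ≥ 0 ∧ 10·Cg ≤ tv²·2^(7(Ka+1))`). [folklore] -/
structure ReadoutAux (K : Type) where
  (θnum θden : ℕ)
  (pθ r34 tv : K)

namespace CertTables

variable {K : Type} [Field K] [LinearOrder K]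

/-! ### Global checks of the surrogates -/

/-- The exact certification of the three surrogates of `ReadoutAux` against the global tables, plus the window facts
`0 ≤ Kb`, `1 ≤ Ka` (so that the shells `-Kb` and `1` the read-outs mention are window shells) and `0 ≤ Cb`. [folklore] -/
def checkReadoutAux (T : CertTables K) (A : ReadoutAux K) : Bool :=
  decide (0 ≤ T.Kb) && decide (1 ≤ T.Ka) && decide (0 ≤ T.Cb) &&
  decide (0 < A.θden) && decide (T.θ * ((A.θden : ℕ) : K) = ((A.θnum : ℕ) : K)) &&
  decide (0 ≤ A.pθ) && decide (A.pθ ^ A.θden * (2 : K) ^ A.θnum ≤ 1) &&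
  decide (0 ≤ A.r34) && decide (A.r34 ^ 4 ≤ (2 : K) ^ (3 * (T.Kb + 1).toNat)) &&
  decide (0 ≤ A.tv) && decide (10 * T.Cg ≤ A.tv ^ 2 * (2 : K) ^ (7 * (T.Ka + 1).toNat))

/-! ### Enclosure data of the crossing states `y = TP u + w'` of the last sub-step -/

/-- `Σ_{1 ≤ q ≤ pdeg} |P q|_c h^q`: radius of the Taylor polynomial `TP u`, `u ∈ [0,h]`, about its constant term at
coordinate `c`. [folklore] -/
def tpRad (T : CertTables K) (N : NodeTables K) (h : K) (c : ℕ) : K :=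
  sumN T.pdeg fun q => |vget (N.P.getD (q + 1) []) c| * h ^ (q + 1)

/-- Constant term `P 0` of the Taylor polynomial at coordinate `c`. [folklore] -/
def tp0 (N : NodeTables K) (c : ℕ) : K := vget (N.P.getD 0 []) c

/-- Lower end of the enclosure of coordinate `c` of `TP u + w'`, `u ∈ [0,h]`, `w' ∈ Ball(sp)` (weights of stage `j`).
[folklore] -/
def yLo (T : CertTables K) (j : ℕ) (N : NodeTables K) (h sp : K) (c : ℕ) : K :=
  tp0 N c - T.tpRad N h c - sp * T.wgt j c

/-- Upper end of the same enclosure. [folklore] -/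
def yHi (T : CertTables K) (j : ℕ) (N : NodeTables K) (h sp : K) (c : ℕ) : K :=
  tp0 N c + T.tpRad N h c + sp * T.wgt j c

/-- Upper bound of `|y_c|` over the same set. [folklore] -/
def yAbs (T : CertTables K) (j : ℕ) (N : NodeTables K) (h sp : K) (c : ℕ) : K :=
  |tp0 N c| + T.tpRad N h c + sp * T.wgt j c

/-- Lower bound `a` of `|y_{i₀,1}|` over the same set (reverse triangle inequality). [folklore] -/
def aLo (T : CertTables K) (j : ℕ) (N : NodeTables K) (h sp : K) : K :=
  |tp0 N (T.idx T.i₀ 1)| - T.tpRad N h (T.idx T.i₀ 1) - sp * T.wgt j (T.idx T.i₀ 1)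

/-- `k + 1 ≤ Ka` for the shell of coordinate `c`, i.e. `c % m + 1 < m`. [folklore] -/
def upInW (T : CertTables K) (c : ℕ) : Bool := decide (c % T.m + 1 < T.m)

/-! ### The clause-family checkers of `Readouts` at stage `j` -/

/-- PRODUCTS: `L1 s' ≤ Λ`, `L1 s' · L1 (s'+1) ≤ Λ` (`s'+1 < S`), and
`L1 s' · (NCi (s'+1) · ∏_{s'+1 ≤ u < s''} (1 + κB u) · (ρO s'' − EO s'')) · L1 s'' ≤ Λ` (`s'+1 < s'' < S`). [folklore] -/
def checkRO_products (T : CertTables K) (j : ℕ) : Bool :=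
  let G := T.stage j
  allN G.S fun s' =>
    decide ((T.step j s').L1 ≤ G.Λ) &&
    decide (s' + 1 < G.S → (T.step j s').L1 * (T.step j (s' + 1)).L1 ≤ G.Λ) &&
    allN G.S fun s'' => decide (s' + 1 < s'' →
      (T.step j s').L1 * ((T.node j (s' + 1)).NCi * prodIco (s' + 1) s'' (fun u => 1 + (T.step j u).κB) *
        ((T.node j s'').ρO - (T.node j s'').EO)) * (T.step j s'').L1 ≤ G.Λ)

/-- `Σ_c |σf_c| ω_c` (weighted dual norm of the section covector). [folklore] -/
def sigAbs (T : CertTables K) (j : ℕ) : K := sumN T.n fun c => |vget (T.stage j).σf c| * T.wgt j c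

/-- SCALARS: `0 < γ`; `Σ |σf_c| ω_c ≤ Nσ`; the `ΛX` clause (exact); `0 ≤ NDL l ∧ NDL l · ΛX · dm ≤ β l` for every face
index below the table lengths; the guard `bb (mC + ρO) h < 1 ∧ 1 ≤ L1 (1 − bb (mC + ρO) h)²` per sub-step. [folklore] -/
def checkRO_scalars (T : CertTables K) (j : ℕ) : Bool :=
  let G := T.stage j
  let N1 := T.node j (G.S - 1)
  let St := T.step j (G.S - 1)
  decide (0 < G.γ) && decide (T.sigAbs j ≤ G.Nσ) &&
  decide ((1 + G.bb * (St.mT + St.Sp) ^ 2 * G.Nσ / G.γ) *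
      ((T.node j 0).NCi * prodIco 0 (G.S - 1) (fun u => 1 + (T.step j u).κB) * (N1.ρO - N1.EO)) * St.L1 ≤ G.ΛX) &&
  allN (max G.NDL.length G.β.length) (fun l =>
    decide (0 ≤ vget G.NDL l) && decide (vget G.NDL l * G.ΛX * G.dm ≤ vget G.β l)) &&
  allN G.S fun s' =>
    decide (G.bb * ((T.node j s').mC + (T.node j s').ρO) * (T.step j s').h < 1) &&
    decide (1 ≤ (T.step j s').L1 * (1 - G.bb * ((T.node j s').mC + (T.node j s').ρO) * (T.step j s').h) ^ 2)

/-- `σf · x` at node `s` (exact value of the section functional at the centre). [folklore] -/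
def sigCtr (T : CertTables K) (j s : ℕ) : K := sumN T.n fun c => vget (T.stage j).σf c * vget (T.node j s).x c

/-- `Σ_{c'} |(σfᵀ Cm)_{c'}| rP_{c'}` at node `s` (sup of `σf ∘ Cm` over the `rP`-box). [folklore] -/
def sigBox (T : CertTables K) (j s : ℕ) : K :=
  sumN T.n fun c' => |sumN T.n fun c => vget (T.stage j).σf c * mget (T.node j s).Cm c c'| * vget (T.node j s).rP c'

/-- SECTION BEFORE / AFTER: `σf·x_{S-1} + sigBox_{S-1} + E_{S-1}·Σ|σf|ω < lev` and
`lev < σf·x_S − sigBox_S − E_S·Σ|σf|ω`. [folklore] -/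
def checkRO_section (T : CertTables K) (j : ℕ) : Bool :=
  let G := T.stage j
  decide (T.sigCtr j (G.S - 1) + T.sigBox j (G.S - 1) + (T.node j (G.S - 1)).E * T.sigAbs j < G.lev) &&
  decide (G.lev < T.sigCtr j G.S - T.sigBox j G.S - (T.node j G.S).E * T.sigAbs j)

/-- Closed-form majorant of `|landD y v z|_c / |Lv|` at window coordinate `c` over the crossing set: `ω_{c⁺}/a +
yAbs_{c⁺}·ω_{(i₀,1)}/a²` if the shell above `c` is a window shell, else `tv·ω_{(i₀,1)}/a²` (`a` = lower bound of
`|y_{i₀,1}|`, `tv` = tail half-width surrogate). [folklore] -/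
def landDMaj (T : CertTables K) (A : ReadoutAux K) (j : ℕ) (N : NodeTables K) (h sp a : K) (c : ℕ) : K :=
  if T.upInW c then
    T.wgt j (c + 1) / a + T.yAbs j N h sp (c + 1) * T.wgt j (T.idx T.i₀ 1) / a ^ 2
  else A.tv * T.wgt j (T.idx T.i₀ 1) / a ^ 2

/-- CROSSING READ-OUTS over `u ∈ [0,h]`, `w' ∈ Ball(Sp)` of the last sub-step (section equation ignored):
`as ≤ a(Sp)`; behind-shell `yAbs_{(i,-Kb)} + Λδτs·ω_{(i,-Kb)} ≤ pθ·Cb·r34` for the four modes; `0 < a(Sp)` and the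
landing-derivative bound `|Lv (nx j)| · Σ_c |ell_{l,c}|·landDMaj_c ≤ NDL l` for every face `l` of stage `nx j`.
[folklore] -/
def checkRO_crossing (T : CertTables K) (A : ReadoutAux K) (j : ℕ) : Bool :=
  let G := T.stage j
  let G' := T.stage G.nx
  let N := T.node j (G.S - 1)
  let St := T.step j (G.S - 1)
  let a := T.aLo j N St.h St.Sp
  decide (G.as ≤ a) &&
  allN 4 (fun i => decide (T.yAbs j N St.h St.Sp (i * T.m) + G.Λ * G.δ * T.τs * T.wgt j (i * T.m) ≤
    A.pθ * T.Cb * A.r34)) &&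
  decide (0 < a) &&
  allN G'.ell.length fun l =>
    decide (|G'.Lv| * sumN T.n (fun c => |vget (G'.ell.getD l []) c| * T.landDMaj A j N St.h St.Sp a c) ≤ vget G.NDL l)

/-- Enclosure `[lo, hi]` of the quotient `Y/D` for `Y ∈ [Ylo, Yhi]`, `D ∈ [a, aHi]`, `0 < a`: extrema at the corners
(`lo = min (Ylo/a) (Ylo/aHi)`, `hi = max (Yhi/a) (Yhi/aHi)`). [folklore] -/
def quotLo (Ylo a aHi : K) : K := min (Ylo / a) (Ylo / aHi)

/-- See `quotLo`. [folklore] -/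
def quotHi (Yhi a aHi : K) : K := max (Yhi / a) (Yhi / aHi)

/-- Numerator enclosure of coordinate `c` of `land y v`: `[yLo_{c⁺}, yHi_{c⁺}]` if the shell above `c` is a window
shell, else the tail box `[-tv, tv]`. [folklore] -/
def numLo (T : CertTables K) (A : ReadoutAux K) (j : ℕ) (N : NodeTables K) (h sp : K) (c : ℕ) : K :=
  if T.upInW c then T.yLo j N h sp (c + 1) else -A.tv

/-- See `numLo`. [folklore] -/
def numHi (T : CertTables K) (A : ReadoutAux K) (j : ℕ) (N : NodeTables K) (h sp : K) (c : ℕ) : K :=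
  if T.upInW c then T.yHi j N h sp (c + 1) else A.tv

/-- Centre of the enclosure of coordinate `c` of `land y v` (`Lv ≥ 0` times the midpoint of the quotient enclosure).
[folklore] -/
def landMid (T : CertTables K) (A : ReadoutAux K) (j : ℕ) (N : NodeTables K) (h sp Lv : K) (c : ℕ) : K :=
  Lv * ((quotLo (T.numLo A j N h sp c) (T.aLo j N h sp) (T.yAbs j N h sp (T.idx T.i₀ 1)) +
    quotHi (T.numHi A j N h sp c) (T.aLo j N h sp) (T.yAbs j N h sp (T.idx T.i₀ 1))) / 2)

/-- Radius of the same enclosure. [folklore] -/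
def landRadius (T : CertTables K) (A : ReadoutAux K) (j : ℕ) (N : NodeTables K) (h sp Lv : K) (c : ℕ) : K :=
  Lv * ((quotHi (T.numHi A j N h sp c) (T.aLo j N h sp) (T.yAbs j N h sp (T.idx T.i₀ 1)) -
    quotLo (T.numLo A j N h sp c) (T.aLo j N h sp) (T.yAbs j N h sp (T.idx T.i₀ 1))) / 2)

/-- Number of face indices to test for the landing polytope clause: beyond it every table entry involved is junk `0`.
[folklore] -/
def nFaces (T : CertTables K) (j : ℕ) : ℕ :=
  let G := T.stage j
  let G' := T.stage G.nx
  max (max (max G'.ell.length G'.ctr.length) (max G'.rad.length G'.s.length)) G.β.length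

/-- BASE LANDING into the successor polytope over `u ∈ [0,h]`, `w' ∈ Ball(SpI)` of the last sub-step (section equation
ignored), every tail vector `v` in the tail box: `0 < a(SpI)`, `0 ≤ Lv (nx j)`, and for every face `l < nFaces`,
`|Σ_c ell_{l,c}·landMid_c − ctr_l| + Σ_c |ell_{l,c}|·landRadius_c + β_l ≤ rad_l − s_l`. [folklore] -/
def checkRO_land (T : CertTables K) (A : ReadoutAux K) (j : ℕ) : Bool :=
  let G := T.stage j
  let G' := T.stage G.nx
  let N := T.node j (G.S - 1)
  let St := T.step j (G.S - 1)
  decide (0 < T.aLo j N St.h St.SpI) && decide (0 ≤ G'.Lv) &&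
  allN (T.nFaces j) fun l =>
    decide (|sumN T.n (fun c => vget (G'.ell.getD l []) c * T.landMid A j N St.h St.SpI G'.Lv c) - vget G'.ctr l| +
      sumN T.n (fun c => |vget (G'.ell.getD l []) c| * T.landRadius A j N St.h St.SpI G'.Lv c) + vget G.β l ≤
      vget G'.rad l - vget G'.s l)

/-- The `Readouts` checks of stage `j` EXCEPT transversality. [folklore] -/
def checkRO_noTrans (T : CertTables K) (A : ReadoutAux K) (j : ℕ) : Bool :=
  T.checkRO_products j && T.checkRO_scalars j && T.checkRO_section j && T.checkRO_crossing A j && T.checkRO_land A j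

/-! ### Transversality (crude Taylor-model lower bound; uses the `coef` table through `QbVec`) -/

/-- `G_{q,q'} := σf · QbVec (P q) (P q')`: the coefficients of the polynomial `g(u) = σf (Qb (TP u) (TP u))` of the
last sub-step (exact in `K`; its meaning as `σf ∘ Qb` rests on the `CoefOK` hypothesis of the soundness files).
[folklore] -/
def trG (T : CertTables K) (j : ℕ) (N : NodeTables K) (q q' : ℕ) : K :=
  sumN T.n fun c => vget (T.stage j).σf c * vget (T.QbVec (N.P.getD q []) (N.P.getD q' [])) c

/-- Crude lower bound `G_{0,0} − Σ_{(q,q') ≠ (0,0)} |G_{q,q'}| h^(q+q')` of `g` on `[0, h]`. [folklore] -/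
def trLow (T : CertTables K) (j : ℕ) (N : NodeTables K) (h : K) : K :=
  sumN (T.pdeg + 1) fun q => sumN (T.pdeg + 1) fun q' =>
    if q + q' = 0 then T.trG j N q q' else -(|T.trG j N q q'| * h ^ (q + q'))

/-- TRANSVERSALITY over `u ∈ [0,h]`, `w' ∈ Ball(Sp)` of the last sub-step: `0 ≤ mT`, `0 ≤ Sp`, the Taylor
polynomial stays in `Ball(mT)` (row test `Σ_q |P q|_c h^q ≤ mT ω_c`), and
`γ ≤ trLow − (2·bb·mT·Sp + bb·Sp²)·Σ_c|σf_c|ω_c` (cross and spread terms through the stage's bilinear bound `bb`).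
[folklore] -/
def checkRO_trans (T : CertTables K) (j : ℕ) : Bool :=
  let G := T.stage j
  let N := T.node j (G.S - 1)
  let St := T.step j (G.S - 1)
  decide (0 ≤ St.mT) && decide (0 ≤ St.Sp) &&
  allN T.n (fun c => decide (T.tpAbs N St.h c ≤ St.mT * T.wgt j c)) &&
  decide (G.γ ≤ T.trLow j N St.h - (2 * G.bb * St.mT * St.Sp + G.bb * St.Sp ^ 2) * T.sigAbs j)

/-- All `Readouts` checks of stage `j`. [folklore] -/
def checkReadoutsStage (T : CertTables K) (A : ReadoutAux K) (j : ℕ) : Bool :=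
  T.checkRO_noTrans A j && T.checkRO_trans j

/-- **The checker of the `Readouts` block**: the surrogate certification and every stage `j ≤ N₀`. [folklore] -/
def checkReadouts (T : CertTables K) (A : ReadoutAux K) : Bool :=
  T.checkReadoutAux A && allN (T.N₀ + 1) fun j => T.checkReadoutsStage A j

end CertTables

end Summit.NavierStokesRegularity.NavierStokesRegularity.Theorems.TaylorModelCert
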